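import Mathlib
import Summits.Ventures.HodgeRepro2.InvariantWedge
import Summits.Ventures.HodgeRepro2.BallHomogeneous

/-!
# Lifting 1-forms on the ball to functions on `U(2,1)` (the Borel–Wallach dictionary in coordinates)

Kernel annex of the blind cell `pub-hodge-repro2` (seat p2), for the Tier-5 sub-step N1
(route/T5-ID-p2.md, Theorem ID(iv) / §ID-4: Borel–Wallach I.1.6 + VII.2.5 — a holomorphic 1-form
on `Γ\𝔹²` is a `K`-equivariant function `F : Γ\U(2,1) → (𝔭⁺)^*`, and the wedge of two 1-forms is
the pointwise exterior product).  In the coordinates of `Hypothesis.lean` (`𝔹² = U(2,1)/K`,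
`K` = stabiliser of the origin, `BallHomogeneous.lean`), the lift of a 1-form `q` is

  `liftForm q g := q(g·0) · J_g(0)`   (the pull-back `(g^* q)(0)`, a row vector = covector at `0`).

* **`liftForm_mul_left`**: `liftForm q (γ g) = liftForm q g` for `γ` leaving `q` invariant —
  the lift is a function on `Γ\U(2,1)`;
* **`liftForm_mul_right`**: `liftForm q (g k) = liftForm q g · J_k(0)` for `k ∈ K` — the lift is
  `K`-equivariant for the linear action of `K` on `(𝔭⁺)^* = (T₀𝔹²)^*` through the Jacobian at the
  origin (`originJacobian_mul`: `k ↦ J_k(0)` is a homomorphism on `K`);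
* **`det_liftForm`**: `det [liftForm q₁ g; liftForm q₂ g] = q₁∧q₂ (g·0) · det J_g(0)` — the wedge
  of the lifts is the lift of the wedge, a function on `Γ\U(2,1)` of `K`-type `det` on `∧²𝔭⁺`.
-/

namespace Summit.Ventures.HodgeRepro2.ShimuraData

open Matrix

/-- The lift of a 1-form `q` on the ball to a function on matrices: `g ↦ q(g·0) · J_g(0)`,
the pull-back of `q` by `g` evaluated at the origin (a covector at `0`). -/
noncomputable def liftForm (q : (Fin 2 → ℂ) → Fin 2 → ℂ) (g : Matrix (Fin 3) (Fin 3) ℂ) :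
    Fin 2 → ℂ :=
  Matrix.vecMul (q (ballAction g 0)) (jacobian g 0)

/-- Invariance of `q` under `α`, as a row-vector identity `q(z) = q(αz) · J_α(z)`. -/
theorem IsInvariantUnder.vecMul_jacobian' {α : Matrix (Fin 3) (Fin 3) ℂ}
    {q : (Fin 2 → ℂ) → Fin 2 → ℂ} (h : IsInvariantUnder α q) {z : Fin 2 → ℂ} (hz : z ∈ ball₂) :
    Matrix.vecMul (q (ballAction α z)) (jacobian α z) = q z := by
  funext j
  rw [h.eq_sum_jacobian hz j]
  rfl

/-- **Left `Γ`-invariance of the lift**: `liftForm q (γ g) = liftForm q g` whenever `q` is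
invariant under `γ`. -/
theorem liftForm_mul_left {γ g : Matrix (Fin 3) (Fin 3) ℂ} (hγ : IsInU21 γ) (hg : IsInU21 g)
    {q : (Fin 2 → ℂ) → Fin 2 → ℂ} (hq : IsInvariantUnder γ q) :
    liftForm q (γ * g) = liftForm q g := by
  simp only [liftForm, hg.ballAction_mul zero_mem_ball₂, jacobian_mul hγ hg zero_mem_ball₂,
    ← Matrix.vecMul_vecMul, hq.vecMul_jacobian' (hg.ballAction_mem_ball₂ zero_mem_ball₂)]

/-- The Jacobian at the origin of an element of the stabiliser `K` of the origin: the linear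
action of `K` on the tangent space `𝔭⁺ = T₀𝔹²`. -/
noncomputable def originJacobian (k : Matrix (Fin 3) (Fin 3) ℂ) : Matrix (Fin 2) (Fin 2) ℂ :=
  jacobian k 0

/-- `k ↦ J_k(0)` is multiplicative on the stabiliser of the origin. -/
theorem originJacobian_mul {k k' : Matrix (Fin 3) (Fin 3) ℂ} (hk : IsInU21 k) (hk' : IsInU21 k')
    (hk'0 : ballAction k' 0 = 0) :
    originJacobian (k * k') = originJacobian k * originJacobian k' := by
  simp only [originJacobian, jacobian_mul hk hk' zero_mem_ball₂, hk'0]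

/-- **Right `K`-equivariance of the lift**: `liftForm q (g k) = liftForm q g · J_k(0)` for `k` in
the stabiliser of the origin. -/
theorem liftForm_mul_right {g k : Matrix (Fin 3) (Fin 3) ℂ} (hg : IsInU21 g) (hk : IsInU21 k)
    (hk0 : ballAction k 0 = 0) (q : (Fin 2 → ℂ) → Fin 2 → ℂ) :
    liftForm q (g * k) = Matrix.vecMul (liftForm q g) (originJacobian k) := by
  simp only [liftForm, originJacobian, hk.ballAction_mul zero_mem_ball₂, hk0,
    jacobian_mul hg hk zero_mem_ball₂, ← Matrix.vecMul_vecMul]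

/-- **The wedge of the lifts is the lift of the wedge**:
`det [liftForm q₁ g; liftForm q₂ g] = q₁∧q₂ (g·0) · det J_g(0)`. -/
theorem det_liftForm (q₁ q₂ : (Fin 2 → ℂ) → Fin 2 → ℂ) (g : Matrix (Fin 3) (Fin 3) ℂ) :
    (Matrix.of ![liftForm q₁ g, liftForm q₂ g]).det = wedgeAt q₁ q₂ (ballAction g 0) * (jacobian g 0).det := by
  have h : Matrix.of ![liftForm q₁ g, liftForm q₂ g] =
      Matrix.of ![q₁ (ballAction g 0), q₂ (ballAction g 0)] * jacobian g 0 := by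
    ext i j
    fin_cases i <;> simp [liftForm, Matrix.mul_apply, Matrix.vecMul, dotProduct]
  rw [h, Matrix.det_mul, Matrix.det_fin_two, wedgeAt]
  simp

/-- The wedge of the lifts is left `Γ`-invariant (for `q₁, q₂` invariant under `γ`). -/
theorem det_liftForm_mul_left {γ g : Matrix (Fin 3) (Fin 3) ℂ} (hγ : IsInU21 γ) (hg : IsInU21 g)
    {q₁ q₂ : (Fin 2 → ℂ) → Fin 2 → ℂ} (h₁ : IsInvariantUnder γ q₁) (h₂ : IsInvariantUnder γ q₂) :
    (Matrix.of ![liftForm q₁ (γ * g), liftForm q₂ (γ * g)]).det =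
      (Matrix.of ![liftForm q₁ g, liftForm q₂ g]).det := by
  rw [liftForm_mul_left hγ hg h₁, liftForm_mul_left hγ hg h₂]

/-- The wedge of the lifts transforms under `k ∈ K` by the character `det J_k(0)` of `K` on
`∧²𝔭⁺`. -/
theorem det_liftForm_mul_right {g k : Matrix (Fin 3) (Fin 3) ℂ} (hg : IsInU21 g) (hk : IsInU21 k)
    (hk0 : ballAction k 0 = 0) (q₁ q₂ : (Fin 2 → ℂ) → Fin 2 → ℂ) :
    (Matrix.of ![liftForm q₁ (g * k), liftForm q₂ (g * k)]).det =
      (Matrix.of ![liftForm q₁ g, liftForm q₂ g]).det * (originJacobian k).det := by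
  have h : Matrix.of ![liftForm q₁ (g * k), liftForm q₂ (g * k)] =
      Matrix.of ![liftForm q₁ g, liftForm q₂ g] * originJacobian k := by
    ext i j
    fin_cases i <;> simp [liftForm_mul_right hg hk hk0, Matrix.mul_apply, Matrix.vecMul, dotProduct]
  rw [h, Matrix.det_mul]

end Summit.Ventures.HodgeRepro2.ShimuraData
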